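import Summits.ValiantsHypothesis.ValiantsHypothesis.Theorems.GrenetZeonDualUnipotentThreeHalvesHeavyTopCompositionBound

/-!
# `GrenetZeon.DualUnipotentThreeHalves` (stmt-ValiantsHypothesis-24318), R2 `HeavyTopLaw` — instrument kernel row
# «§8 enumerator soundness», LAYER 3c: `HeavyTopInst 5 7` FROM `ι(7) ≤ 19`
# (INSTANCES.md v2.2a §7–§8: «no IRREDUCIBLE nilpotent subspace of M₇(ℂ) has the submaximal dimension 20»)

As in layer 3b (`…HeavyTopCompositionBound.lean :: heavyTopInst_four_six_of_iota`), with `n = 5`, `m = 7`, `n² = 25`: a coarsening cut with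
`2 ≤ #{lvl < t} ≤ 5` costs `2·5 + C(a,2) + C(7−a,2) ≤ 21 < 25` by Gerstenhaber (✓ `flagCheap_of_invariant_levels`); otherwise
the level sizes are `(7)`, `(1,6)`, `(6,1)` or `(1,5,1)`, the big block is an IRREDUCIBLE nilpotent space, and the costs are
`5 + ι(7) ≤ 24`, `10 + 14`, `10 + 14`, `15 + 9`, all `≤ 24 < 25` — where `14 = C(6,2) − 1` and `9 = C(5,2) − 1` are the TRIVIAL
bounds for irreducible nilpotent spaces (`finrank_le_choose_two_sub_one_of_irreducible`: at Gerstenhaber's equality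
`dim V = C(s,2)` the space is simultaneously strictly upper triangularisable, ✓ `deSeguinsPazzis2013_equality_holds`, so it
kills a common vector and is reducible for `s ≥ 2`).  Only `ι(7) ≤ 19` is a HYPOTHESIS.

* `heavyTopInst_five_seven_of_iota7 (hι7) : HeavyTopInst 5 7`.

HONEST LABEL: a CONDITIONAL instance row (`ι(7) ≤ 19` is an OPEN finite question); nothing here proves `HeavyTopInst 5 7`
outright, nor `HeavyTopLaw`, 24318, S3b; `VP ≠ VNP` is NOT proved; no summit statement is proved here.  No definitions, no
named facts.  (Desk RULING #299 (a); instance table val-port-3 g2; critic of record val-idea-crit-3 g4.)  [folklore bookkeeping]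
-/

noncomputable section

-- single-conjunct layout: Sub = Summit, duplicated namespace component intended
set_option linter.dupNamespace false

namespace Summit.ValiantsHypothesis.ValiantsHypothesis.Theorems.GrenetZeon.HeavyTopCompositionBound

open MvPolynomial Matrix
open scoped BigOperators
open Summit.ValiantsHypothesis.ValiantsHypothesis.Cruxes.TwoDimCoefficients.DimTwoCases (AffMat IsAffine)
open Summit.ValiantsHypothesis.ValiantsHypothesis.Theorems.GrenetZeon.RadicalSplit
open Summit.ValiantsHypothesis.ValiantsHypothesis.Theorems.GrenetZeon.HeavyTopInvariantFlag (flagCheap_of_invariant_levels)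
open Literature.LinearAlgebra.Matrix.GerstenhaberNilpotentSubspace (finrank_le_choose_two deSeguinsPazzis2013_equality_holds)
open Literature.LinearAlgebra.Matrix (IsStrictUpper)

/-! ## §1 The trivial bound for IRREDUCIBLE nilpotent spaces: `dim ≤ C(s,2) − 1` -/

/-- **An irreducible nilpotent linear space of `s × s` matrices (`s ≥ 2`) has dimension `≤ C(s,2) − 1`.**  At Gerstenhaber's
equality `dim V = C(s,2)` one constant `P` makes every member strictly upper triangular (✓ `deSeguinsPazzis2013_equality_holds`),
so every member kills `P⁻¹ e₀` and the line it spans is a proper non-zero invariant subspace. [Gerstenhaber 1958 / de Seguins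
Pazzis 2013, via the tree] -/
theorem finrank_le_choose_two_sub_one_of_irreducible {s : ℕ} (hs : 2 ≤ s) (V : Submodule ℂ (Matrix (Fin s) (Fin s) ℂ))
    (hV : ∀ A ∈ V, IsNilpotent A)
    (hirr : ∀ U : Submodule ℂ (Fin s → ℂ), (∀ A ∈ V, ∀ x ∈ U, A *ᵥ x ∈ U) → U = ⊥ ∨ U = ⊤) :
    Module.finrank ℂ V ≤ s.choose 2 - 1 := by
  classical
  have hle := finrank_le_choose_two s V hV
  by_contra hlt
  have heq : Module.finrank ℂ V = s.choose 2 := by omega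
  obtain ⟨P, hP, hPV⟩ := deSeguinsPazzis2013_equality_holds ℂ s V hV heq
  have hPdet : IsUnit P.det := (Matrix.isUnit_iff_isUnit_det P).1 hP
  -- the common kernel vector `P⁻¹ e₀`
  set v : Fin s → ℂ := P⁻¹ *ᵥ Pi.single (⟨0, by omega⟩ : Fin s) 1 with hv
  have hkill : ∀ A ∈ V, A *ᵥ v = 0 := by
    intro A hA
    have hsu : IsStrictUpper (P * A * P⁻¹) := (hPV A).1 hA
    have hA' : A = P⁻¹ * (P * A * P⁻¹) * P := by
      rw [← Matrix.mul_assoc, ← Matrix.mul_assoc, Matrix.nonsing_inv_mul P hPdet, Matrix.one_mul, Matrix.mul_assoc,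
        Matrix.nonsing_inv_mul P hPdet, Matrix.mul_one]
    rw [hv, Matrix.mulVec_mulVec, hA', Matrix.mul_assoc, Matrix.mul_assoc, Matrix.mul_nonsing_inv P hPdet, Matrix.mul_one,
      ← Matrix.mulVec_mulVec, Matrix.mulVec_single_one]
    have h0 : (P * A * P⁻¹).col (⟨0, by omega⟩ : Fin s) = 0 := by
      funext i
      exact hsu i ⟨0, by omega⟩ (Fin.mk_le_of_le_val (Nat.zero_le _))
    rw [h0, Matrix.mulVec_zero]
  have hv0 : v ≠ 0 := by
    intro h
    have h1 : P *ᵥ v = Pi.single (⟨0, by omega⟩ : Fin s) 1 := by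
      rw [hv, Matrix.mulVec_mulVec, Matrix.mul_nonsing_inv P hPdet, Matrix.one_mulVec]
    rw [h, Matrix.mulVec_zero] at h1
    have := congr_fun h1 ⟨0, by omega⟩
    simp at this
  have hUinv : ∀ A ∈ V, ∀ x ∈ (ℂ ∙ v), A *ᵥ x ∈ (ℂ ∙ v) := by
    intro A hA x hx
    obtain ⟨c, rfl⟩ := Submodule.mem_span_singleton.1 hx
    rw [Matrix.mulVec_smul, hkill A hA, smul_zero]
    exact Submodule.zero_mem _
  rcases hirr (ℂ ∙ v) hUinv with hbot | htop
  · exact hv0 ((Submodule.span_singleton_eq_bot).1 hbot)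
  · have h1 := finrank_span_singleton (K := ℂ) hv0
    rw [htop, finrank_top, Module.finrank_fin_fun] at h1
    omega

/-! ## §2 `HeavyTopInst 5 7` from `ι(7) ≤ 19` -/

set_option maxHeartbeats 1600000 in
/-- **`ι(7) ≤ 19 ⟹ HeavyTopInst 5 7`** (INSTANCES.md v2.2a §7, kernel form; the bound is a HYPOTHESIS on irreducible nilpotent
subspaces of `M_7(ℂ)`; the `(1,6)`, `(6,1)`, `(1,5,1)` compositions use the trivial irreducible bounds `C(6,2) − 1 = 14`,
`C(5,2) − 1 = 9`).  Conditional instance row; NOT a proof of `HeavyTopInst 5 7`, `HeavyTopLaw` or 24318.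
[folklore bookkeeping over Theorem G] -/
theorem heavyTopInst_five_seven_of_iota7
    (hι7 : ∀ V : Submodule ℂ (Matrix (Fin 7) (Fin 7) ℂ), (∀ A ∈ V, IsNilpotent A) →
      (∀ U : Submodule ℂ (Fin 7 → ℂ), (∀ A ∈ V, ∀ x ∈ U, A *ᵥ x ∈ U) → U = ⊥ ∨ U = ⊤) →
      Module.finrank ℂ V ≤ 19) :
    HeavyTopInst 5 7 := by
  classical
  intro N hN hnil _
  -- the nilpotent space `W = ℂ·N(0) + N_lin` and its composition chain in matrix clothes
  obtain ⟨T, hT⟩ := exists_topMap_linPart N hN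
  obtain ⟨P, L, lvl, hlvl, _hLm, hne, hblk, hirr⟩ :=
    exists_block_conj (((ℂ ∙ N.map (MvPolynomial.eval 0)) ⊔ LinearMap.range T : Submodule ℂ (Matrix (Fin 7) (Fin 7) ℂ)) :
      Set (Matrix (Fin 7) (Fin 7) ℂ))
  have hPW : ∀ A ∈ (ℂ ∙ N.map (MvPolynomial.eval 0)) ⊔ LinearMap.range T, ∀ i j : Fin 7, lvl i < lvl j →
      ((P : Matrix (Fin 7) (Fin 7) ℂ) * A * (↑P⁻¹ : Matrix (Fin 7) (Fin 7) ℂ)) i j = 0 := fun A hA => hblk A hA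
  have hpoly := pencil_blockUpper_of_forall_mem N T hT P lvl hPW
  -- Gerstenhaber and the irreducible bounds, per block
  have hGer : ∀ (s : ℕ) (V : Submodule ℂ (Matrix (Fin s) (Fin s) ℂ)), (∀ B ∈ V, IsNilpotent B) →
      (∀ U : Submodule ℂ (Fin s → ℂ), (∀ B ∈ V, ∀ x ∈ U, B *ᵥ x ∈ U) → U = ⊥ ∨ U = ⊤) →
      Module.finrank ℂ V ≤ s.choose 2 := fun s V hV _ => finrank_le_choose_two s V hV
  have hbound : ∀ (t : ℕ), t < L → ∀ (s : ℕ) (e : {i : Fin 7 // lvl i = t} ≃ Fin s) (β : ℕ),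
      (∀ V : Submodule ℂ (Matrix (Fin s) (Fin s) ℂ), (∀ B ∈ V, IsNilpotent B) →
        (∀ U : Submodule ℂ (Fin s → ℂ), (∀ B ∈ V, ∀ x ∈ U, B *ᵥ x ∈ U) → U = ⊥ ∨ U = ⊤) →
        Module.finrank ℂ V ≤ β) →
      Module.finrank ℂ (Submodule.span ℂ (Set.range fun v : Fin 5 × Fin 5 → ℂ =>
        Matrix.reindex e e (((P : Matrix (Fin 7) (Fin 7) ℂ) * linPart N v * (↑P⁻¹ : Matrix (Fin 7) (Fin 7) ℂ)).toBlock
          (fun i => lvl i = t) (fun i => lvl i = t)))) ≤ β :=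
    fun t ht s e β hβ => finrank_blockSpan_le N hN hnil T hT P lvl hPW t e β hβ (hirr t ht s e)
  -- the cut profile
  have hcut0 : (Finset.univ.filter (fun i : Fin 7 => lvl i < 0)).card = 0 := by simp
  have hcutL : ∀ t, L ≤ t → (Finset.univ.filter (fun i : Fin 7 => lvl i < t)).card = 7 := cut_eq_card lvl hlvl
  have hstep : ∀ t, t < L → (Finset.univ.filter (fun i : Fin 7 => lvl i < t)).card <
      (Finset.univ.filter (fun i : Fin 7 => lvl i < t + 1)).card := by
    intro t ht; rw [cut_succ]; have := hne t ht; omega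
  have hL1 : 1 ≤ L := Nat.succ_le_of_lt (Nat.lt_of_le_of_lt (Nat.zero_le _) (hlvl 0))
  by_cases hA : ∃ t, 2 ≤ (Finset.univ.filter (fun i : Fin 7 => lvl i < t)).card ∧
      (Finset.univ.filter (fun i : Fin 7 => lvl i < t)).card ≤ 5
  · -- COARSEN at the cut `t`: two levels, Gerstenhaber
    obtain ⟨t, h2, h5⟩ := hA
    let lvl' : Fin 7 → ℕ := fun i => if lvl i < t then 0 else 1
    have hlvl' : ∀ i, lvl' i < 2 := fun i => by dsimp only [lvl']; split_ifs <;> norm_num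
    have hblock' : ∀ i j : Fin 7, lvl' i < lvl' j →
        ((P : Matrix (Fin 7) (Fin 7) ℂ).map C * N * (↑P⁻¹ : Matrix (Fin 7) (Fin 7) ℂ).map C :
          Matrix (Fin 7) (Fin 7) (MvPolynomial (Fin 5 × Fin 5) ℂ)) i j = 0 := by
      intro i j hij
      apply hpoly i j
      dsimp only [lvl'] at hij
      split_ifs at hij with hi hj <;> omega
    have hc0 : Fintype.card {i : Fin 7 // lvl' i = 0} = (Finset.univ.filter (fun i : Fin 7 => lvl i < t)).card := by
      rw [Fintype.card_subtype]; congr 1; ext i; simp [lvl']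
    have hc1 : Fintype.card {i : Fin 7 // lvl' i = 1} = 7 - (Finset.univ.filter (fun i : Fin 7 => lvl i < t)).card := by
      rw [Fintype.card_subtype]
      have h := Finset.card_filter_add_card_filter_not (s := (Finset.univ : Finset (Fin 7))) (fun i => lvl i < t)
      rw [Finset.card_univ, Fintype.card_fin] at h
      have h' : (Finset.univ.filter (fun i : Fin 7 => lvl' i = 1)) = Finset.univ.filter (fun i => ¬ lvl i < t) := by
        ext i; simp [lvl']
      rw [h']; omega
    refine flagCheap_of_invariant_levels N hN hnil P lvl' 2 (by norm_num) hlvl' hblock' ?_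
    rw [Finset.sum_range_succ, Finset.sum_range_succ, Finset.sum_range_zero, zero_add, hc0, hc1]
    set x := (Finset.univ.filter (fun i : Fin 7 => lvl i < t)).card with hx
    interval_cases x <;> decide
  · -- every cut is `≤ 1` or `≥ 6`: the composition is `(7)`, `(1,6)`, `(6,1)` or `(1,5,1)`
    obtain ⟨a, ha⟩ : ∃ a : ℕ → ℕ, ∀ t, a t = (Finset.univ.filter (fun i : Fin 7 => lvl i < t)).card :=
      ⟨_, fun _ => rfl⟩
    have ha0 : a 0 = 0 := by rw [ha]; simp
    have haL : ∀ t, L ≤ t → a t = 7 := fun t ht => by rw [ha]; exact hcutL t ht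
    have hst : ∀ t, t < L → a t < a (t + 1) := fun t ht => by rw [ha, ha]; exact hstep t ht
    have hsize : ∀ t, (Finset.univ.filter (fun i : Fin 7 => lvl i = t)).card = a (t + 1) - a t := by
      intro t; rw [ha, ha, cut_succ]; omega
    have hB : ∀ t, a t ≤ 1 ∨ 6 ≤ a t := by
      intro t
      by_contra h
      push Not at h
      exact hA ⟨t, by rw [← ha]; omega, by rw [← ha]; omega⟩
    have h1 : a 0 < a 1 := hst 0 (by omega)
    have hB1 := hB 1
    have hB2 := hB 2
    have hB3 := hB 3
    -- how many levels?
    rcases Nat.lt_or_ge L 4 with hL4 | hL4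
    swap
    · -- `L ≥ 4` is impossible
      exfalso
      have h2 : a 1 < a 2 := hst 1 (by omega)
      have h3 : a 2 < a 3 := hst 2 (by omega)
      have h4 : a 3 < a 4 := hst 3 (by omega)
      have h6 : a 4 ≤ 7 := by
        rw [ha]
        calc _ ≤ (Finset.univ : Finset (Fin 7)).card := Finset.card_filter_le _ _
          _ = 7 := by simp
      omega
    interval_cases L
    · -- one level: the whole space is IRREDUCIBLE for `W`, size 7
      have hs0 : (Finset.univ.filter (fun i : Fin 7 => lvl i = 0)).card = 7 := by
        rw [hsize, haL 1 le_rfl, ha0]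
      obtain ⟨e0⟩ := exists_level_equiv lvl 0 7 hs0
      refine flagCheap_of_block_dims N hN P lvl 1 le_rfl hlvl hpoly (fun _ => 19) (fun t => ?_) (by decide)
      fin_cases t
      exact ⟨7, e0, hbound 0 (by omega) 7 e0 19 hι7⟩
    · -- two levels: `(1,6)` or `(6,1)`
      have hc2 : a 2 = 7 := haL 2 le_rfl
      have h2 : a 1 < a 2 := hst 1 (by omega)
      have hs0 : (Finset.univ.filter (fun i : Fin 7 => lvl i = 0)).card = a 1 - a 0 := hsize 0
      have hs1 : (Finset.univ.filter (fun i : Fin 7 => lvl i = 1)).card = a 2 - a 1 := hsize 1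
      rcases hB1 with hlo | hhi
      · -- `(1,6)`
        rw [ha0] at hs0
        have hs0' : (Finset.univ.filter (fun i : Fin 7 => lvl i = 0)).card = 1 := by rw [hs0]; omega
        have hs1' : (Finset.univ.filter (fun i : Fin 7 => lvl i = 1)).card = 6 := by rw [hs1]; omega
        obtain ⟨e0⟩ := exists_level_equiv lvl 0 1 hs0'
        obtain ⟨e1⟩ := exists_level_equiv lvl 1 6 hs1'
        refine flagCheap_of_block_dims N hN P lvl 2 (by norm_num) hlvl hpoly (fun t => if t = 0 then 0 else 14)
          (fun t => ?_) (by decide)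
        fin_cases t
        · exact ⟨1, e0, (hbound 0 (by omega) 1 e0 (Nat.choose 1 2) (hGer 1)).trans (by decide)⟩
        · exact ⟨6, e1, (hbound 1 (by omega) 6 e1 (Nat.choose 6 2 - 1)
            (finrank_le_choose_two_sub_one_of_irreducible (by norm_num))).trans (by decide)⟩
      · -- `(6,1)`
        rw [ha0] at hs0
        have hs0' : (Finset.univ.filter (fun i : Fin 7 => lvl i = 0)).card = 6 := by rw [hs0]; omega
        have hs1' : (Finset.univ.filter (fun i : Fin 7 => lvl i = 1)).card = 1 := by rw [hs1]; omega
        obtain ⟨e0⟩ := exists_level_equiv lvl 0 6 hs0'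
        obtain ⟨e1⟩ := exists_level_equiv lvl 1 1 hs1'
        refine flagCheap_of_block_dims N hN P lvl 2 (by norm_num) hlvl hpoly (fun t => if t = 0 then 14 else 0)
          (fun t => ?_) (by decide)
        fin_cases t
        · exact ⟨6, e0, (hbound 0 (by omega) 6 e0 (Nat.choose 6 2 - 1)
            (finrank_le_choose_two_sub_one_of_irreducible (by norm_num))).trans (by decide)⟩
        · exact ⟨1, e1, (hbound 1 (by omega) 1 e1 (Nat.choose 1 2) (hGer 1)).trans (by decide)⟩
    · -- three levels: `(1,5,1)`
      have h2 : a 1 < a 2 := hst 1 (by omega)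
      have h3 : a 2 < a 3 := hst 2 (by omega)
      have hc3 : a 3 = 7 := haL 3 le_rfl
      have hs0 : (Finset.univ.filter (fun i : Fin 7 => lvl i = 0)).card = 1 := by
        have h : (Finset.univ.filter (fun i : Fin 7 => lvl i = 0)).card = a 1 - a 0 := hsize 0
        rw [h, ha0]; omega
      have hs1 : (Finset.univ.filter (fun i : Fin 7 => lvl i = 1)).card = 5 := by
        have h : (Finset.univ.filter (fun i : Fin 7 => lvl i = 1)).card = a 2 - a 1 := hsize 1
        rw [h]; omega
      have hs2 : (Finset.univ.filter (fun i : Fin 7 => lvl i = 2)).card = 1 := by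
        have h : (Finset.univ.filter (fun i : Fin 7 => lvl i = 2)).card = a 3 - a 2 := hsize 2
        rw [h]; omega
      obtain ⟨e0⟩ := exists_level_equiv lvl 0 1 hs0
      obtain ⟨e1⟩ := exists_level_equiv lvl 1 5 hs1
      obtain ⟨e2⟩ := exists_level_equiv lvl 2 1 hs2
      refine flagCheap_of_block_dims N hN P lvl 3 (by norm_num) hlvl hpoly (fun t => if t = 1 then 9 else 0)
        (fun t => ?_) (by decide)
      fin_cases t
      · exact ⟨1, e0, (hbound 0 (by omega) 1 e0 (Nat.choose 1 2) (hGer 1)).trans (by decide)⟩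
      · exact ⟨5, e1, (hbound 1 (by omega) 5 e1 (Nat.choose 5 2 - 1)
            (finrank_le_choose_two_sub_one_of_irreducible (by norm_num))).trans (by decide)⟩
      · exact ⟨1, e2, (hbound 2 (by omega) 1 e2 (Nat.choose 1 2) (hGer 1)).trans (by decide)⟩

end Summit.ValiantsHypothesis.ValiantsHypothesis.Theorems.GrenetZeon.HeavyTopCompositionBound

end
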